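import Summits.HubbardSuperconductivity.HubbardSuperconductivity.Theorems.NodalWardXYVisonPairCostIRDefs
import Literature.MathematicalPhysics.QuantumLattice.FermionTorusCutBookkeeping

/-!
# Infrared assembly for the line `Sketch` of the crux `NodalWardXY.VisonPairCost`

`MirrorReduction → FreeResolventDecay → SymbolIntegralBounds → InfraredWindow`
(stmt-HubbardSuperconductivity-1266, registered stub `stub_irAssembly`): pure bookkeeping, with
the model-independent inequalities in `Literature/.../FermionTorusCutBookkeeping.lean`.

* near pairs (`a` in the string: column `x < R`, rows `0,1`; `b` in rows `0,1`, column `y ≥ R`):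
  column distance `d = min(x+L−y, y−x) ≥ 1`, interpolation of the two column decay bounds
  `‖G‖² ≤ u^{7/4} v^{1/4} d^{-9/4}` and `d^{-9/4} ≤ (R−x)^{-9/8}(y+1−R)^{-9/8} + (x+1)^{-9/8}(L−y)^{-9/8}`;
  each column carries `≤ 4` such orbitals, so the double sum is `≤ 32 ζ(9/8)²`;
* far pairs (`b` in rows `⌊L/2⌋, ⌊L/2⌋+1`): row distance `≥ ⌊L/2⌋ − 1 ≥ L/8`, `≤ 4L · 4L` pairs,
  second row decay bound, `tL ≥ 1`;
* with `1 + |log t| ≤ K t^{-ε}`: `S(t) ≤ K t^{-3/8}` on `[1/L, t₀]`, so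
  `|D_t| ≤ cS + cS²(1+|log t|) ≤ K' t^{-7/8}`, which integrates (`integral_rpow`), and the
  boundary term is `L⁻¹ K' L^{7/8} ≤ K'`.
-/

noncomputable section

-- tree namespace Summit.HubbardSuperconductivity.HubbardSuperconductivity (D-0017)
set_option linter.dupNamespace false

namespace Summit.HubbardSuperconductivity.HubbardSuperconductivity.Theorems.VisonPairCost

open Literature.Probability.LatticeModels Literature.MathematicalPhysics.QuantumLattice
open Summit.HubbardSuperconductivity.HubbardSuperconductivity.Theses.NodalWardXY
open Finset MeasureTheory
open scoped Matrix

section IR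

variable {L : ℕ} [NeZero L]

variable (L) in
/-- The string has at most `4R` orbitals (`≤ 4` per column). -/
theorem card_strA_le (R : ℕ) : (strA L R).card ≤ 4 * R :=
  calc (strA L R).card
      ≤ ((range R).biUnion fun c₀ => univ.filter fun o : Orb (FermionTorus 2 L) =>
          (colOf L o).val = c₀ ∧ (rowOf L o = 0 ∨ rowOf L o = 1)).card := by
        refine card_le_card fun o ho => ?_
        simp only [strA, mem_filter, mem_univ, true_and] at ho
        simp only [mem_biUnion, mem_range, mem_filter, mem_univ, true_and]
        exact ⟨_, ho.1, rfl, ho.2⟩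
    _ ≤ ∑ c₀ ∈ range R, 4 :=
        card_biUnion_le.trans (sum_le_sum fun c₀ _ => card_orb_col_rows01_le c₀)
    _ = 4 * R := by simp [mul_comm]

/-! ### The two pair bounds -/

/-- Near pairs (string orbital `a`, complement orbital `b` in rows `0,1` with column `≥ R`):
interpolated column decay with the distance weight factorised through the cut. -/
theorem near_pair_bound (hFRD : FreeResolventDecay) (hL : 4 ≤ L) {μ Δ₀ t C Kl : ℝ}
    (ht : 0 < t) (hC : 0 ≤ C) (hKl : 0 ≤ Kl)
    (hΦ1 : colPhi1 L μ Δ₀ t ≤ C * (1 + |Real.log t|)) (hΦ2 : colPhi2 L μ Δ₀ t ≤ C / t)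
    (hΛ : 1 + |Real.log t| ≤ Kl * t ^ (-(1 / 14) : ℝ)) {R : ℕ} {a b : Orb (FermionTorus 2 L)}
    (ha : a ∈ strA L R) (hb : R ≤ (colOf L b).val) :
    ‖freeG L μ Δ₀ t a b‖ ^ 2 ≤
      (C * Kl / 4) ^ (7 / 4 : ℝ) * (Real.pi * C / 4) ^ (1 / 4 : ℝ) * t ^ (-(3 / 8) : ℝ) *
        (((R - (colOf L a).val : ℕ) : ℝ) ^ (-(9 / 8) : ℝ) *
            (((colOf L b).val + 1 - R : ℕ) : ℝ) ^ (-(9 / 8) : ℝ) +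
          (((colOf L a).val + 1 : ℕ) : ℝ) ^ (-(9 / 8) : ℝ) *
            ((L - (colOf L b).val : ℕ) : ℝ) ^ (-(9 / 8) : ℝ)) := by
  have hg : ∀ n : ℕ, 0 ≤ (n : ℝ) ^ (-(9 / 8) : ℝ) := fun n => Real.rpow_nonneg (Nat.cast_nonneg n) _
  obtain ⟨hx, -⟩ := (mem_filter.mp ha).2
  have hy : (colOf L b).val < L := ZMod.val_lt _
  have hxy : (colOf L a).val < (colOf L b).val := lt_of_lt_of_le hx hb
  have hd : colDist L a b =
      min ((colOf L a).val + L - (colOf L b).val) ((colOf L b).val - (colOf L a).val) :=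
    zmod_min_val_sub_eq hxy
  have hd1 : 1 ≤ colDist L a b := by rw [hd]; exact le_min (by omega) (by omega)
  have hdpos : (0 : ℝ) < colDist L a b := by exact_mod_cast hd1
  obtain ⟨h1, h2⟩ := (hFRD L hL μ Δ₀ t ht a b).1 hd1
  have hu : ‖freeG L μ Δ₀ t a b‖ ≤ C * Kl / 4 * t ^ (-(1 / 14) : ℝ) / (colDist L a b : ℝ) :=
    calc ‖freeG L μ Δ₀ t a b‖ ≤ colPhi1 L μ Δ₀ t / (4 * (colDist L a b : ℝ)) := h1
      _ ≤ C * (Kl * t ^ (-(1 / 14) : ℝ)) / (4 * (colDist L a b : ℝ)) :=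
          div_le_div_of_nonneg_right (hΦ1.trans (mul_le_mul_of_nonneg_left hΛ hC)) (by positivity)
      _ = _ := by ring
  have hv : ‖freeG L μ Δ₀ t a b‖ ≤ Real.pi * C / 4 * t⁻¹ / (colDist L a b : ℝ) ^ 2 :=
    calc ‖freeG L μ Δ₀ t a b‖ ≤ Real.pi / 4 * colPhi2 L μ Δ₀ t / ((colDist L a b : ℝ) ^ 2) := h2
      _ ≤ Real.pi / 4 * (C / t) / ((colDist L a b : ℝ) ^ 2) := by gcongr
      _ = _ := by ring
  have hsq := sq_le_interp_rpow (norm_nonneg _) (by positivity) (by positivity) ht hdpos hu hv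
  rw [show (-(7 * (1 / 14) / 4 + 1 / 4) : ℝ) = -(3 / 8) by norm_num] at hsq
  refine hsq.trans (mul_le_mul_of_nonneg_left ?_ (by positivity))
  have hA0 := mul_nonneg (hg (R - (colOf L a).val)) (hg ((colOf L b).val + 1 - R))
  have hB0 := mul_nonneg (hg ((colOf L a).val + 1)) (hg (L - (colOf L b).val))
  rcases min_choice ((colOf L a).val + L - (colOf L b).val)
    ((colOf L b).val - (colOf L a).val) with hm | hm <;> rw [hd, hm]
  · have := natCast_rpow_le (n := (colOf L a).val + L - (colOf L b).val)
      (p := (colOf L a).val + 1) (q := L - (colOf L b).val) (by omega) (by omega) (by omega)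
    linarith
  · have := natCast_rpow_le (n := (colOf L b).val - (colOf L a).val)
      (p := R - (colOf L a).val) (q := (colOf L b).val + 1 - R) (by omega) (by omega) (by omega)
    linarith

/-- Far pairs (string orbital `a`, complement orbital `b` in the far rows `⌊L/2⌋, ⌊L/2⌋+1`):
row decay at distance `≥ ⌊L/2⌋ − 1 ≥ L/8`. -/
theorem far_pair_bound (hFRD : FreeResolventDecay) (hL : 4 ≤ L) {μ Δ₀ t C : ℝ} (ht : 0 < t)
    (hC : 0 ≤ C) (hΨ2 : rowPhi2 L μ Δ₀ t ≤ C / t) {R : ℕ} {a b : Orb (FermionTorus 2 L)}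
    (ha : a ∈ strA L R)
    (hb : rowOf L b = ((L / 2 : ℕ) : ZMod L) ∨ rowOf L b = ((L / 2 + 1 : ℕ) : ZMod L)) :
    ‖freeG L μ Δ₀ t a b‖ ^ 2 ≤ 256 * Real.pi ^ 2 * C ^ 2 / (t ^ 2 * (L : ℝ) ^ 4) := by
  obtain ⟨-, ha'⟩ := (mem_filter.mp ha).2
  have hva : (rowOf L a).val ≤ 1 := by
    rcases ha' with h | h <;> rw [h]
    · simp
    · rw [ZMod.val_one_eq_one_mod]; exact Nat.mod_le 1 L
  have hvb : (rowOf L b).val = L / 2 ∨ (rowOf L b).val = L / 2 + 1 := by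
    rcases hb with h | h <;> rw [h, ZMod.val_natCast, Nat.mod_eq_of_lt (by omega)]
    · exact Or.inl rfl
    · exact Or.inr rfl
  have hrow : L / 2 - 1 ≤ rowDist L a b := by
    have e : rowDist L a b = min ((rowOf L a).val + L - (rowOf L b).val)
        ((rowOf L b).val - (rowOf L a).val) := zmod_min_val_sub_eq (by omega)
    rw [e]; exact le_min (by omega) (by omega)
  have hrd1 : 1 ≤ rowDist L a b := le_trans (by omega) hrow
  have h8 : (L : ℝ) / 8 ≤ rowDist L a b := by
    have : (L : ℝ) ≤ 8 * rowDist L a b := by exact_mod_cast (by omega : L ≤ 8 * rowDist L a b)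
    linarith
  obtain ⟨-, h2⟩ := (hFRD L hL μ Δ₀ t ht a b).2 hrd1
  have hLpos : (0 : ℝ) < L := Nat.cast_pos.mpr (by omega)
  have hG : ‖freeG L μ Δ₀ t a b‖ ≤ 16 * Real.pi * C / (t * (L : ℝ) ^ 2) :=
    calc ‖freeG L μ Δ₀ t a b‖ ≤ Real.pi / 4 * rowPhi2 L μ Δ₀ t / (rowDist L a b : ℝ) ^ 2 := h2
      _ ≤ Real.pi / 4 * (C / t) / ((L : ℝ) / 8) ^ 2 := by gcongr
      _ = 16 * Real.pi * C / (t * (L : ℝ) ^ 2) := by field_simp; ring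
  calc ‖freeG L μ Δ₀ t a b‖ ^ 2 ≤ (16 * Real.pi * C / (t * (L : ℝ) ^ 2)) ^ 2 := by gcongr
    _ = _ := by field_simp; ring

/-! ### STEP 1: the crossing sum on `[1/L, t₀]` -/

/-- `S(t) ≤ K t^{-3/8}` on `[1/L, t₀]`, uniformly in `L ≥ 4`, `2R ≤ L`. -/
theorem crossS_le (hFRD : FreeResolventDecay) {μ Δ₀ t₀ C : ℝ} (ht₀ : 1 ≤ t₀) (hC : 0 ≤ C)
    (hSIB : ∀ (L : ℕ) [NeZero L], 4 ≤ L → ∀ t : ℝ, 1 / (L : ℝ) ≤ t → t ≤ t₀ →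
      colPhi1 L μ Δ₀ t ≤ C * (1 + |Real.log t|) ∧ colPhi2 L μ Δ₀ t ≤ C / t ∧
        rowPhi1 L μ Δ₀ t ≤ C * (1 + |Real.log t|) ∧ rowPhi2 L μ Δ₀ t ≤ C / t) :
    ∃ K : ℝ, 0 ≤ K ∧ ∀ (L : ℕ) [NeZero L], 4 ≤ L → ∀ R : ℕ, 2 * R ≤ L → ∀ t : ℝ,
      1 / (L : ℝ) ≤ t → t ≤ t₀ → crossS L μ Δ₀ R t ≤ K * t ^ (-(3 / 8) : ℝ) := by
  obtain ⟨Kl, hKl, hlog⟩ := exists_one_add_abs_log_le (by norm_num : (0 : ℝ) < 1 / 14) ht₀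
  have hsum : Summable fun n : ℕ => (n : ℝ) ^ (-(9 / 8) : ℝ) :=
    Real.summable_nat_rpow.mpr (by norm_num)
  have hg0 : ∀ n : ℕ, 0 ≤ (n : ℝ) ^ (-(9 / 8) : ℝ) := fun n => Real.rpow_nonneg (Nat.cast_nonneg n) _
  obtain ⟨Z, hZ⟩ : ∃ Z : ℝ, Z = ∑' n : ℕ, (n : ℝ) ^ (-(9 / 8) : ℝ) := ⟨_, rfl⟩
  have hZ0 : 0 ≤ Z := hZ ▸ tsum_nonneg hg0
  obtain ⟨KG, hKG⟩ : ∃ KG : ℝ, KG = (C * Kl / 4) ^ (7 / 4 : ℝ) * (Real.pi * C / 4) ^ (1 / 4 : ℝ) :=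
    ⟨_, rfl⟩
  have hKG0 : 0 ≤ KG := by rw [hKG]; positivity
  have ht₀pos : (0 : ℝ) < t₀ := by linarith
  refine ⟨32 * Z ^ 2 * KG + 4096 * Real.pi ^ 2 * C ^ 2 * t₀ ^ (3 / 8 : ℝ), by positivity, ?_⟩
  intro L _ hL R hR t hLt htt₀
  have hLpos : (0 : ℝ) < L := Nat.cast_pos.mpr (by omega)
  have ht : 0 < t := lt_of_lt_of_le (by positivity) hLt
  have htL : 1 ≤ t * L := by rwa [div_le_iff₀ hLpos] at hLt
  obtain ⟨hΦ1, hΦ2, -, hΨ2⟩ := hSIB L hL t hLt htt₀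
  have hΛ := hlog t ht htt₀
  -- the near and far parts of the complement
  obtain ⟨Bn, hBn⟩ : ∃ Bn : Finset (Orb (FermionTorus 2 L)), Bn = univ.filter fun o =>
      R ≤ (colOf L o).val ∧ (rowOf L o = 0 ∨ rowOf L o = 1) := ⟨_, rfl⟩
  obtain ⟨Bf, hBf⟩ : ∃ Bf : Finset (Orb (FermionTorus 2 L)), Bf = univ.filter fun o =>
      rowOf L o = ((L / 2 : ℕ) : ZMod L) ∨ rowOf L o = ((L / 2 + 1 : ℕ) : ZMod L) := ⟨_, rfl⟩
  have hB : mirB L R = Bn ∪ Bf := by rw [hBn, hBf, mirB, filter_or]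
  have hsplit : crossS L μ Δ₀ R t ≤ (∑ a ∈ strA L R, ∑ b ∈ Bn, ‖freeG L μ Δ₀ t a b‖ ^ 2) +
      ∑ a ∈ strA L R, ∑ b ∈ Bf, ‖freeG L μ Δ₀ t a b‖ ^ 2 := by
    rw [crossS, ← sum_add_distrib]
    refine sum_le_sum fun a _ => ?_
    rw [hB, ← sum_union_inter]
    exact le_add_of_nonneg_right (sum_nonneg fun _ _ => sq_nonneg _)
  -- near part: four single sums along at-most-`4`-to-one column maps
  have hfib : ∀ (s : Finset (Orb (FermionTorus 2 L))) (m : Orb (FermionTorus 2 L) → ℕ)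
      (c : ℕ → ℕ), (∀ o ∈ s, (colOf L o).val = c (m o) ∧ (rowOf L o = 0 ∨ rowOf L o = 1)) →
      ∑ o ∈ s, ((m o : ℕ) : ℝ) ^ (-(9 / 8) : ℝ) ≤ 4 * Z := by
    intro s m c hs
    refine (sum_le_of_fiber_card_le s m _ 4 hg0 hsum fun n => ?_).trans_eq (by rw [hZ]; norm_num)
    refine (card_le_card fun o ho => ?_).trans (card_orb_col_rows01_le (c n))
    rw [mem_filter] at ho
    obtain ⟨ho, rfl⟩ := ho
    exact mem_filter.mpr ⟨mem_univ _, hs o ho⟩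
  have h1 := hfib (strA L R) (fun a => R - (colOf L a).val) (fun n => R - n) fun a ha => by
    obtain ⟨hx, hrow⟩ := (mem_filter.mp ha).2; exact ⟨by omega, hrow⟩
  have h2 := hfib Bn (fun b => (colOf L b).val + 1 - R) (fun n => n + R - 1) fun b hb => by
    rw [hBn] at hb; obtain ⟨hy, hrow⟩ := (mem_filter.mp hb).2; exact ⟨by omega, hrow⟩
  have h3 := hfib (strA L R) (fun a => (colOf L a).val + 1) (fun n => n - 1) fun a ha => by
    obtain ⟨-, hrow⟩ := (mem_filter.mp ha).2; exact ⟨by omega, hrow⟩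
  have h4 := hfib Bn (fun b => L - (colOf L b).val) (fun n => L - n) fun b hb => by
    rw [hBn] at hb; obtain ⟨-, hrow⟩ := (mem_filter.mp hb).2
    have := ZMod.val_lt (colOf L b); exact ⟨by omega, hrow⟩
  have hs0 : ∀ (s : Finset (Orb (FermionTorus 2 L))) (m : Orb (FermionTorus 2 L) → ℕ),
      0 ≤ ∑ o ∈ s, ((m o : ℕ) : ℝ) ^ (-(9 / 8) : ℝ) := fun s m => sum_nonneg fun o _ => hg0 _
  have hnear : ∑ a ∈ strA L R, ∑ b ∈ Bn, ‖freeG L μ Δ₀ t a b‖ ^ 2 ≤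
      32 * Z ^ 2 * KG * t ^ (-(3 / 8) : ℝ) :=
    calc ∑ a ∈ strA L R, ∑ b ∈ Bn, ‖freeG L μ Δ₀ t a b‖ ^ 2
        ≤ ∑ a ∈ strA L R, ∑ b ∈ Bn,
            (C * Kl / 4) ^ (7 / 4 : ℝ) * (Real.pi * C / 4) ^ (1 / 4 : ℝ) * t ^ (-(3 / 8) : ℝ) *
              (((R - (colOf L a).val : ℕ) : ℝ) ^ (-(9 / 8) : ℝ) *
                  (((colOf L b).val + 1 - R : ℕ) : ℝ) ^ (-(9 / 8) : ℝ) +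
                (((colOf L a).val + 1 : ℕ) : ℝ) ^ (-(9 / 8) : ℝ) *
                  ((L - (colOf L b).val : ℕ) : ℝ) ^ (-(9 / 8) : ℝ)) :=
          sum_le_sum fun a ha => sum_le_sum fun b hb => near_pair_bound hFRD hL ht hC hKl hΦ1
            hΦ2 hΛ ha (by rw [hBn] at hb; exact (mem_filter.mp hb).2.1)
      _ = KG * t ^ (-(3 / 8) : ℝ) *
            ((∑ a ∈ strA L R, ((R - (colOf L a).val : ℕ) : ℝ) ^ (-(9 / 8) : ℝ)) *
                (∑ b ∈ Bn, (((colOf L b).val + 1 - R : ℕ) : ℝ) ^ (-(9 / 8) : ℝ)) +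
              (∑ a ∈ strA L R, (((colOf L a).val + 1 : ℕ) : ℝ) ^ (-(9 / 8) : ℝ)) *
                (∑ b ∈ Bn, ((L - (colOf L b).val : ℕ) : ℝ) ^ (-(9 / 8) : ℝ))) := by
          rw [hKG, sum_mul_sum, sum_mul_sum, ← sum_add_distrib, mul_sum]
          refine sum_congr rfl fun a _ => ?_
          rw [← sum_add_distrib, mul_sum]
      _ ≤ KG * t ^ (-(3 / 8) : ℝ) * ((4 * Z) * (4 * Z) + (4 * Z) * (4 * Z)) :=
          mul_le_mul_of_nonneg_left (add_le_add (mul_le_mul h1 h2 (hs0 _ _) (by linarith))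
            (mul_le_mul h3 h4 (hs0 _ _) (by linarith))) (mul_nonneg hKG0 (Real.rpow_nonneg ht.le _))
      _ = 32 * Z ^ 2 * KG * t ^ (-(3 / 8) : ℝ) := by ring
  -- far part: `≤ 4L · 4L` pairs, each `≤ 256 π² C² / (t² L⁴)`, and `tL ≥ 1`
  have hfar : ∑ a ∈ strA L R, ∑ b ∈ Bf, ‖freeG L μ Δ₀ t a b‖ ^ 2 ≤ 4096 * Real.pi ^ 2 * C ^ 2 := by
    have hA : ((strA L R).card : ℝ) ≤ 4 * L := by
      have h := card_strA_le L R
      exact_mod_cast (by omega : (strA L R).card ≤ 4 * L)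
    have hBfc : (Bf.card : ℝ) ≤ 4 * L := by
      have h1 : (univ.filter fun o : Orb (FermionTorus 2 L) =>
          rowOf L o = ((L / 2 : ℕ) : ZMod L)).card ≤ 2 * L := card_orb_row_le _
      have h2 : (univ.filter fun o : Orb (FermionTorus 2 L) =>
          rowOf L o = ((L / 2 + 1 : ℕ) : ZMod L)).card ≤ 2 * L := card_orb_row_le _
      have : Bf.card ≤ 4 * L := by
        rw [hBf, filter_or]; exact (card_union_le _ _).trans (by omega)
      exact_mod_cast this
    calc ∑ a ∈ strA L R, ∑ b ∈ Bf, ‖freeG L μ Δ₀ t a b‖ ^ 2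
        ≤ ∑ a ∈ strA L R, ∑ b ∈ Bf, 256 * Real.pi ^ 2 * C ^ 2 / (t ^ 2 * (L : ℝ) ^ 4) :=
          sum_le_sum fun a ha => sum_le_sum fun b hb =>
            far_pair_bound hFRD hL ht hC hΨ2 ha (by rw [hBf] at hb; exact (mem_filter.mp hb).2)
      _ = (strA L R).card * (Bf.card * (256 * Real.pi ^ 2 * C ^ 2 / (t ^ 2 * (L : ℝ) ^ 4))) := by
          simp only [sum_const, nsmul_eq_mul]
      _ ≤ (4 * L) * ((4 * L) * (256 * Real.pi ^ 2 * C ^ 2 / (t ^ 2 * (L : ℝ) ^ 4))) := by gcongr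
      _ = 4096 * Real.pi ^ 2 * C ^ 2 / (t * L) ^ 2 := by field_simp; ring
      _ ≤ 4096 * Real.pi ^ 2 * C ^ 2 := div_le_self (by positivity) (one_le_pow₀ htL)
  calc crossS L μ Δ₀ R t ≤ 32 * Z ^ 2 * KG * t ^ (-(3 / 8) : ℝ) + 4096 * Real.pi ^ 2 * C ^ 2 :=
        hsplit.trans (add_le_add hnear hfar)
    _ ≤ 32 * Z ^ 2 * KG * t ^ (-(3 / 8) : ℝ) +
          4096 * Real.pi ^ 2 * C ^ 2 * (t₀ ^ (3 / 8 : ℝ) * t ^ (-(3 / 8) : ℝ)) :=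
        add_le_add le_rfl (le_mul_of_one_le_right (by positivity)
          (one_le_rpow_mul_rpow_neg ht htt₀ (by norm_num)))
    _ = _ := by ring

end IR

/-! ### The assembly -/

/-- **Infrared assembly** (registered stub of line `Sketch`): the mirror reduction, the free
resolvent decay and the symbol integral bounds give the `L`-uniform bound
`∫_{1/L}^{t₀} |D_t| dt + L⁻¹|D_{1/L}| ≤ C(μ, Δ₀, t₀)` — via the pointwise majorant
`|D_t| ≤ K t^{-7/8}` on `[1/L, t₀]`. -/
theorem stub_irAssembly :
    MirrorReduction → FreeResolventDecay → SymbolIntegralBounds → InfraredWindow := by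
  intro hMR hFRD hSIB μ hμ hμ0 Δ₀ hΔ₀ t₀ ht₀
  obtain ⟨c, hc, hD⟩ := hMR μ Δ₀
  obtain ⟨C, hC, hΦ⟩ := hSIB μ hμ hμ0 Δ₀ hΔ₀ t₀ ht₀
  obtain ⟨K, hK, hS⟩ := crossS_le hFRD ht₀ hC hΦ
  obtain ⟨Kl, hKl, hlog⟩ := exists_one_add_abs_log_le (by norm_num : (0 : ℝ) < 1 / 8) ht₀
  have ht₀pos : 0 < t₀ := by linarith
  obtain ⟨KD, hKD⟩ : ∃ KD : ℝ, KD = c * K * t₀ ^ (1 / 2 : ℝ) + c * K ^ 2 * Kl := ⟨_, rfl⟩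
  have hKD0 : 0 ≤ KD := by rw [hKD]; positivity
  -- STEP 2: the pointwise majorant on `[1/L, t₀]`
  have hpt : ∀ (L : ℕ) [NeZero L], 4 ≤ L → ∀ R : ℕ, 2 * R ≤ L → ∀ t : ℝ, 1 / (L : ℝ) ≤ t →
      t ≤ t₀ → |logDetKernel (visonNambu L μ Δ₀ R) (visonNambu L μ Δ₀ 0) t| ≤
        KD * t ^ (-(7 / 8) : ℝ) := by
    intro L _ hL R hR t hLt htt₀
    have hLpos : (0 : ℝ) < L := Nat.cast_pos.mpr (by omega)
    have ht : 0 < t := lt_of_lt_of_le (by positivity) hLt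
    have hSt := hS L hL R hR t hLt htt₀
    have hS0 : 0 ≤ crossS L μ Δ₀ R t :=
      sum_nonneg fun _ _ => sum_nonneg fun _ _ => sq_nonneg _
    have hΛ := hlog t ht htt₀
    have hΛ0 : 0 ≤ 1 + |Real.log t| := by positivity
    have htr := rpow_neg_le_rpow_neg_add (α := 3 / 8) ht htt₀ (by norm_num : (0 : ℝ) ≤ 1 / 2)
    have e1 : (t ^ (-(3 / 8) : ℝ)) ^ 2 * t ^ (-(1 / 8) : ℝ) = t ^ (-(7 / 8) : ℝ) := by
      rw [show (t ^ (-(3 / 8) : ℝ)) ^ 2 = (t ^ (-(3 / 8) : ℝ)) ^ (2 : ℝ) by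
          rw [← Real.rpow_natCast]; norm_num,
        ← Real.rpow_mul ht.le, ← Real.rpow_add ht]
      norm_num
    calc |logDetKernel (visonNambu L μ Δ₀ R) (visonNambu L μ Δ₀ 0) t|
        ≤ c * crossS L μ Δ₀ R t + c * crossS L μ Δ₀ R t ^ 2 * (1 + |Real.log t|) :=
          hD L hL R hR t ht
      _ ≤ c * (K * t ^ (-(3 / 8) : ℝ)) +
            c * (K * t ^ (-(3 / 8) : ℝ)) ^ 2 * (Kl * t ^ (-(1 / 8) : ℝ)) := by gcongr
      _ ≤ c * (K * (t₀ ^ (1 / 2 : ℝ) * t ^ (-(3 / 8 + 1 / 2) : ℝ))) +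
            c * (K * t ^ (-(3 / 8) : ℝ)) ^ 2 * (Kl * t ^ (-(1 / 8) : ℝ)) := by gcongr
      _ = c * K * t₀ ^ (1 / 2 : ℝ) * t ^ (-(3 / 8 + 1 / 2) : ℝ) +
            c * K ^ 2 * Kl * ((t ^ (-(3 / 8) : ℝ)) ^ 2 * t ^ (-(1 / 8) : ℝ)) := by ring
      _ = KD * t ^ (-(7 / 8) : ℝ) := by rw [e1, hKD]; norm_num; ring
  -- STEP 3–5: integrate the majorant over `Ioc (1/L) t₀` and add the boundary term
  refine ⟨8 * KD * t₀ ^ (1 / 8 : ℝ) + KD, ?_⟩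
  intro L _ hL R hR
  have hLpos : (0 : ℝ) < L := Nat.cast_pos.mpr (by omega)
  have hL1 : (1 : ℝ) / L ≤ 1 := by
    rw [div_le_one hLpos]; exact_mod_cast (by omega : 1 ≤ L)
  have hLt₀ : 1 / (L : ℝ) ≤ t₀ := hL1.trans ht₀
  have hapos : (0 : ℝ) < 1 / L := by positivity
  have hint : ∫ t in Set.Ioc (1 / (L : ℝ)) t₀,
      |logDetKernel (visonNambu L μ Δ₀ R) (visonNambu L μ Δ₀ 0) t| ≤ 8 * KD * t₀ ^ (1 / 8 : ℝ) := by
    have hmaj : IntegrableOn (fun t : ℝ => KD * t ^ (-(7 / 8) : ℝ)) (Set.Ioc (1 / (L : ℝ)) t₀) :=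
      (intervalIntegrable_iff_integrableOn_Ioc_of_le hLt₀).mp
        ((intervalIntegral.intervalIntegrable_rpow' (a := 1 / (L : ℝ)) (b := t₀)
          (by norm_num : (-1 : ℝ) < -(7 / 8))).const_mul KD)
    calc ∫ t in Set.Ioc (1 / (L : ℝ)) t₀, |logDetKernel (visonNambu L μ Δ₀ R) (visonNambu L μ Δ₀ 0) t|
        ≤ ∫ t in Set.Ioc (1 / (L : ℝ)) t₀, KD * t ^ (-(7 / 8) : ℝ) := by
          refine integral_mono_of_nonneg (Filter.Eventually.of_forall fun t => abs_nonneg _) hmaj ?_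
          filter_upwards [ae_restrict_mem measurableSet_Ioc] with t ht
          exact hpt L hL R hR t ht.1.le ht.2
      _ = KD * ((t₀ ^ (-(7 / 8) + 1 : ℝ) - (1 / (L : ℝ)) ^ (-(7 / 8) + 1 : ℝ)) / (-(7 / 8) + 1)) := by
          rw [← intervalIntegral.integral_of_le hLt₀, intervalIntegral.integral_const_mul,
            integral_rpow (Or.inl (by norm_num))]
      _ ≤ KD * (t₀ ^ (-(7 / 8) + 1 : ℝ) / (-(7 / 8) + 1)) :=
          mul_le_mul_of_nonneg_left (div_le_div_of_nonneg_right
            (sub_le_self _ (Real.rpow_nonneg hapos.le _)) (by norm_num)) hKD0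
      _ = 8 * KD * t₀ ^ (1 / 8 : ℝ) := by
          rw [show (-(7 / 8) + 1 : ℝ) = 1 / 8 by norm_num]; ring
  have hbdry : 1 / (L : ℝ) * |logDetKernel (visonNambu L μ Δ₀ R) (visonNambu L μ Δ₀ 0) (1 / (L : ℝ))|
      ≤ KD := by
    have h := hpt L hL R hR (1 / (L : ℝ)) le_rfl hLt₀
    have hpow : (1 / (L : ℝ)) ^ (-(7 / 8) : ℝ) ≤ (1 / (L : ℝ)) ^ (-1 : ℝ) :=
      Real.rpow_le_rpow_of_exponent_ge hapos hL1 (by norm_num)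
    calc 1 / (L : ℝ) * |logDetKernel (visonNambu L μ Δ₀ R) (visonNambu L μ Δ₀ 0) (1 / (L : ℝ))|
        ≤ 1 / (L : ℝ) * (KD * (1 / (L : ℝ)) ^ (-(7 / 8) : ℝ)) := mul_le_mul_of_nonneg_left h hapos.le
      _ ≤ 1 / (L : ℝ) * (KD * (1 / (L : ℝ)) ^ (-1 : ℝ)) := by gcongr
      _ = KD := by rw [Real.rpow_neg_one]; field_simp
  linarith [hint, hbdry]

end Summit.HubbardSuperconductivity.HubbardSuperconductivity.Theorems.VisonPairCost

end
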